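import Summits.BirchSwinnertonDyer.BirchSwinnertonDyer.Theses.TameQuarticManinParity
import Summits.BirchSwinnertonDyer.BirchSwinnertonDyer.Theorems.TeichmullerTwistDescentTwistLatticeUnstarred
import HarnessLib

/-!
# Route `TameQuarticManinParity`, LINE 25b (bsd-idea-3 g8), support β `TwistNeronLatticeKodairaThree`
# (stmt-BirchSwinnertonDyer-22823) — PROVED BY NAME: the Néron lattice of the RAMIFIED `−3`-twist at a type-III prime `3`
# is `s⁻¹ Λ(W)`, `s² = −3`

Cell `pub/bsd-wall`, D-0145 line `route-BirchSwinnertonDyer-TeichmullerTwistDescent`, seat `bsd-line-ttd-p1` g10,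
working the planner-of-record's TQMP LINE 25b. BSD is NOT proved by this; Manin's conjecture is not proved by this.

## Statement (the route decl, paraphrased)

For `W/ℚ` globally minimal with Néron-type period pair `L`, additive at `3` (displayed, not used) with
`ord₃ Δ_min(W) = 3` (Kodaira III), EVERY globally minimal model `C` of `W ⊗ χ₋₃` (`∃ v, v • W.quadraticTwist (−3) = C`)
with Néron-type pair `L'`, and every `s` with `s² = −3`: `z ∈ Λ(C) ↔ s z ∈ Λ(W)`.

## Proof

This is the `q = 3` instance of this base's `TeichmullerTwistDescent.neronLattice_quadraticTwist_pStar_of_lt_six`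
(seat g2/g4: Stevens 1989 Lemma (5.2) / Pal 2012 Prop. 2.5 with semistability at `q` replaced by `ord_q Δ_min < 6` —
the integral `q*`-twist model is then globally minimal, `isGloballyMinimal_twistModel_pStar_of_lt_six`, its Néron pair
is `s⁻¹ L`, and two globally minimal models differ by `u = ±1`), read at `3* = (−1)¹·3 = −3` and `3 < 6`.
Design: theorems only; no definition, no named fact, no `sorry`; axioms `propext`, `Classical.choice`, `Quot.sound`.
-/

set_option autoImplicit false
-- D-0017: single-problem summit, so `Summit.BirchSwinnertonDyer.BirchSwinnertonDyer.…` repeats a namespace BY DESIGN.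
set_option linter.dupNamespace false

noncomputable section

open scoped Classical

namespace Summit.BirchSwinnertonDyer.BirchSwinnertonDyer.Theorems.TameQuarticManinParity

open WeierstrassCurve Literature.NumberTheory.EllipticCurves Literature.NumberTheory.EllipticCurves.ModularForms
  Summit.BirchSwinnertonDyer.BirchSwinnertonDyer.Theses.TameQuarticManinParity

/-- **β `TwistNeronLatticeKodairaThree`** (stmt-BirchSwinnertonDyer-22823), by name: `Λ(C) = s⁻¹Λ(W)` for every globally
minimal model `C` of the `−3`-twist of a globally minimal `W` with `ord₃ Δ_min(W) = 3`, `s² = −3`.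
[cite: Stevens1989, Lemma (5.2) p. 96] [cite: Pal2012, Prop. 2.5 and Lemma 3.1] -/
theorem twistNeronLatticeKodairaThree_proof : TwistNeronLatticeKodairaThree := by
  unfold TwistNeronLatticeKodairaThree
  intro W _ _ L hL _ h3 C _ _ hC L' hL' s hs z
  haveI : Fact (Nat.Prime 3) := ⟨Nat.prime_three⟩
  have hd : ((((-1 : ℤ) ^ (3 / 2) * (3 : ℕ) : ℤ)) : ℚ) = (-3 : ℚ) := by norm_num
  have hC' : ∃ v : VariableChange ℚ, v • W.quadraticTwist ((((-1 : ℤ) ^ (3 / 2) * (3 : ℕ) : ℤ)) : ℚ) = C := by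
    rw [hd]; exact hC
  have hs' : s ^ 2 = ((((-1 : ℤ) ^ (3 / 2) * (3 : ℕ) : ℤ)) : ℂ) := by rw [hs]; norm_num
  exact TeichmullerTwistDescent.neronLattice_quadraticTwist_pStar_of_lt_six W hL (by norm_num) (by omega) C hC' hL'
    hs' z

end Summit.BirchSwinnertonDyer.BirchSwinnertonDyer.Theorems.TameQuarticManinParity

end
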